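import Literature.Analysis.FunctionSpaces.SmoothParametricIntegral
import HarnessLib

/-!
# Smooth dependence on parameters of integrals over a bounded set

Analysis/FunctionSpaces support file, companion of `SmoothParametricIntegral` (which treats
interval integrals `∫ σ in a..b`). Here the integration variable ranges over a **bounded subset
`K` of a finite-dimensional space `Y`** with a measure finite on compact sets (Lebesgue measure,
or its restrictions), the form needed when a smooth function is averaged over a fundamental
domain of a lattice (e.g. the unit cube of `ℝ^d`, for means over the flat torus) or over a ball
(Evans, *PDE*, App. C.4; Hörmander, *ALPDO I*, Thm. 1.1.7 ff.: differentiation under the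
integral sign):

* `Literature.Analysis.FunctionSpaces.hasFDerivAt_parametric_setIntegral` — if `H : Y × P → F` is
  `C¹` and `K ⊆ Y` is bounded and measurable, then `p ↦ ∫ y in K, H (y, p) ∂μ` is differentiable with derivative
  `∫ y in K, D_p H (y, p) ∂μ` (Mathlib's `hasFDerivAt_integral_of_dominated_of_fderiv_le`, the
  dominating constant coming from continuity of `DH` on the compact
  `closure K × closedBall p 1`);
* `Literature.Analysis.FunctionSpaces.contDiff_parametric_setIntegral` — if `H` is `C^∞` then so
  is `p ↦ ∫ y in K, H (y, p) ∂μ` (induction on the order through Mathlib's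
  `contDiff_succ_iff_fderiv_apply`, verbatim the argument of
  `contDiff_parametric_intervalIntegral`).

## Mathlib search

Mathlib (this pin) has one derivative under the integral sign
(`hasFDerivAt_integral_of_dominated_of_fderiv_le`) and continuity of parametric integrals over
compact sets (`continuous_parametric_integral_of_continuous`), but no `ContDiff` statement for
parametric integrals (searched `contDiff` + `integral` in `Analysis/Calculus`,
`MeasureTheory/Integral`: none). The tree has the interval version
(`contDiff_parametric_intervalIntegral`, `SmoothParametricIntegral`).

## References

* L. C. Evans, *Partial Differential Equations*, 2nd ed. (2010), App. C.4.
* L. Hörmander, *The Analysis of Linear Partial Differential Operators I*, 2nd ed. (1990),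
  Thm. 1.1.7–1.1.9.
-/

noncomputable section

open MeasureTheory Set Filter Metric Bornology
open _root_.Topology
open scoped ContDiff

namespace Literature.Analysis.FunctionSpaces

variable {Y : Type*} [NormedAddCommGroup Y] [NormedSpace ℝ Y] [FiniteDimensional ℝ Y]
  [MeasurableSpace Y] [BorelSpace Y]
variable {P : Type*} [NormedAddCommGroup P] [NormedSpace ℝ P] [FiniteDimensional ℝ P]
variable {F : Type*} [NormedAddCommGroup F] [NormedSpace ℝ F]
variable {μ : Measure Y} [IsFiniteMeasureOnCompacts μ]

omit [FiniteDimensional ℝ P] [MeasurableSpace Y] [BorelSpace Y] [FiniteDimensional ℝ Y] in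
/-- The partial derivative in the parameter of `H : Y × P → F` at `(y, p)`, as a continuous
linear map `P →L F`: `D H (y, p) ∘ (0, ·)`. [folklore] -/
theorem hasFDerivAt_comp_prodMk_param {H : Y × P → F} {n : WithTop ℕ∞} (hH : ContDiff ℝ n H)
    (hn : n ≠ 0) (y : Y) (p : P) :
    HasFDerivAt (fun q : P => H (y, q))
      ((fderiv ℝ H (y, p)).comp (ContinuousLinearMap.inr ℝ Y P)) p := by
  have h1 : HasFDerivAt H (fderiv ℝ H (y, p)) (y, p) :=
    ((hH.differentiable hn) (y, p)).hasFDerivAt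
  have h2 : HasFDerivAt (fun q : P => ((y, q) : Y × P)) (ContinuousLinearMap.inr ℝ Y P) p :=
    (hasFDerivAt_const y p).prodMk (hasFDerivAt_id p)
  exact h1.comp p h2

omit [FiniteDimensional ℝ P] [NormedSpace ℝ F] in
/-- A continuous function is integrable on a bounded set (for a measure finite on compact sets):
it is bounded on the compact closure, which has finite measure. [folklore] -/
theorem integrableOn_of_continuous_of_isBounded {f : Y → F} (hf : Continuous f) {K : Set Y}
    (hK : IsBounded K) : IntegrableOn f K μ :=
  (hf.continuousOn.integrableOn_compact hK.isCompact_closure).mono_set subset_closure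

/-- **One derivative under the integral sign over a bounded set.** If `H : Y × P → F` is `C¹`
and `K ⊆ Y` is bounded then `p ↦ ∫ y in K, H (y, p) ∂μ` has derivative
`∫ y in K, D H (y, p) ∘ (0, ·) ∂μ` at every `p` (Evans, App. C.4; Mathlib's
`hasFDerivAt_integral_of_dominated_of_fderiv_le` with the constant bound given by continuity of
`DH` on the compact `closure K × closedBall p 1`). [folklore] -/
theorem hasFDerivAt_parametric_setIntegral {K : Set Y} (hK : IsBounded K) (hKm : MeasurableSet K)
    {H : Y × P → F} {n : WithTop ℕ∞} (hH : ContDiff ℝ n H) (hn : n ≠ 0) (p₀ : P) :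
    HasFDerivAt (fun p : P => ∫ y in K, H (y, p) ∂μ)
      (∫ y in K, (fderiv ℝ H (y, p₀)).comp (ContinuousLinearMap.inr ℝ Y P) ∂μ) p₀ := by
  have hHc : Continuous H := hH.continuous
  have hDc : Continuous (fderiv ℝ H) := hH.continuous_fderiv hn
  -- the derivative family and a uniform bound on `closure K × closedBall p₀ 1`
  set F' : P → Y → P →L[ℝ] F :=
    fun p y => (fderiv ℝ H (y, p)).comp (ContinuousLinearMap.inr ℝ Y P) with hF'
  have hF'c : Continuous (fun q : Y × P => F' q.2 q.1) := by
    simp only [hF']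
    exact ((ContinuousLinearMap.compL ℝ P (Y × P) F).flip
      (ContinuousLinearMap.inr ℝ Y P)).continuous.comp hDc
  obtain ⟨C, hC⟩ : ∃ C, ∀ q ∈ closure K ×ˢ closedBall p₀ 1, ‖F' q.2 q.1‖ ≤ C := by
    have hK' : IsCompact (closure K ×ˢ closedBall p₀ (1 : ℝ)) :=
      hK.isCompact_closure.prod (isCompact_closedBall p₀ 1)
    obtain ⟨C, hC⟩ := hK'.exists_bound_of_continuousOn hF'c.continuousOn
    exact ⟨C, hC⟩
  have hsl : ∀ p : P, Continuous fun y : Y => H (y, p) := fun p =>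
    hHc.comp (continuous_id.prodMk continuous_const)
  refine hasFDerivAt_integral_of_dominated_of_fderiv_le (μ := μ.restrict K)
    (F := fun p y => H (y, p)) (F' := F') (bound := fun _ => C)
    (ball_mem_nhds p₀ one_pos) ?_ ?_ ?_ ?_ ?_ ?_
  · exact Eventually.of_forall fun p => (hsl p).aestronglyMeasurable
  · exact integrableOn_of_continuous_of_isBounded (hsl p₀) hK
  · exact (hF'c.comp (continuous_id.prodMk continuous_const)).aestronglyMeasurable
  · rw [ae_restrict_iff' hKm]
    refine Eventually.of_forall fun y hy p hp => hC (y, p) ⟨subset_closure hy, ?_⟩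
    exact mem_closedBall.2 (le_of_lt (mem_ball.1 hp))
  · have hμK : μ K ≠ ⊤ :=
      ((measure_mono subset_closure).trans_lt hK.isCompact_closure.measure_lt_top).ne
    exact integrableOn_const (hs := hμK)
  · exact Eventually.of_forall fun y p _ => hasFDerivAt_comp_prodMk_param hH hn y p

/-- The derivative of `p ↦ ∫ y in K, H (y, p) ∂μ` in the direction `v` is the parametric integral
of the smooth function `(y, p) ↦ D H (y, p) (0, v)`. [folklore] -/
theorem fderiv_parametric_setIntegral_apply {K : Set Y} (hK : IsBounded K) (hKm : MeasurableSet K)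
    {H : Y × P → F} {n : WithTop ℕ∞} (hH : ContDiff ℝ n H) (hn : n ≠ 0) (p : P) (v : P) :
    fderiv ℝ (fun p : P => ∫ y in K, H (y, p) ∂μ) p v =
      ∫ y in K, fderiv ℝ H (y, p) ((0 : Y), v) ∂μ := by
  rw [(hasFDerivAt_parametric_setIntegral hK hKm hH hn p).fderiv]
  have hDc : Continuous (fderiv ℝ H) := hH.continuous_fderiv hn
  have hc : Continuous fun y : Y => (fderiv ℝ H (y, p)).comp (ContinuousLinearMap.inr ℝ Y P) :=
    ((ContinuousLinearMap.compL ℝ P (Y × P) F).flip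
      (ContinuousLinearMap.inr ℝ Y P)).continuous.comp
      (hDc.comp (continuous_id.prodMk continuous_const))
  rw [ContinuousLinearMap.integral_apply (integrableOn_of_continuous_of_isBounded hc hK)]
  rfl

/-- `p ↦ ∫ y in K, H (y, p) ∂μ` is differentiable for `C¹` integrands and bounded `K`. [folklore] -/
theorem differentiable_parametric_setIntegral {K : Set Y} (hK : IsBounded K) (hKm : MeasurableSet K)
    {H : Y × P → F} {n : WithTop ℕ∞} (hH : ContDiff ℝ n H) (hn : n ≠ 0) :
    Differentiable ℝ fun p : P => ∫ y in K, H (y, p) ∂μ :=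
  fun p => (hasFDerivAt_parametric_setIntegral hK hKm hH hn p).differentiableAt

/-- `C^n` regularity of parametric integrals of smooth integrands over a bounded set, every
`n : ℕ` (induction on `n`, over all smooth `H` at once). [folklore] -/
theorem contDiff_nat_parametric_setIntegral {K : Set Y} (hK : IsBounded K) (hKm : MeasurableSet K) :
    ∀ (n : ℕ) {H : Y × P → F}, ContDiff ℝ ∞ H →
      ContDiff ℝ n fun p : P => ∫ y in K, H (y, p) ∂μ
  | 0, H, hH => by
    have h1 : (∞ : WithTop ℕ∞) ≠ 0 := by exact_mod_cast WithTop.coe_ne_zero.2 (by decide)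
    rw [Nat.cast_zero, contDiff_zero]
    exact (differentiable_parametric_setIntegral hK hKm hH h1).continuous
  | n + 1, H, hH => by
    have h1 : (∞ : WithTop ℕ∞) ≠ 0 := by exact_mod_cast WithTop.coe_ne_zero.2 (by decide)
    rw [Nat.cast_succ, contDiff_succ_iff_fderiv_apply]
    refine ⟨differentiable_parametric_setIntegral hK hKm hH h1, fun h => ?_, fun v => ?_⟩
    · exact absurd h (by exact_mod_cast WithTop.coe_ne_top)
    · have hv : (fun p : P => fderiv ℝ (fun p : P => ∫ y in K, H (y, p) ∂μ) p v) =
          fun p : P => ∫ y in K, fderiv ℝ H (y, p) ((0 : Y), v) ∂μ :=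
        funext fun p => fderiv_parametric_setIntegral_apply hK hKm hH h1 p v
      rw [hv]
      refine contDiff_nat_parametric_setIntegral hK hKm n (H := fun q => fderiv ℝ H q ((0 : Y), v)) ?_
      exact (hH.fderiv_right (m := ∞) le_rfl).clm_apply contDiff_const

/-- **Smooth dependence on parameters, bounded domain of integration.** If `H : Y × P → F` is
`C^∞` (`Y`, `P` finite dimensional) and `K ⊆ Y` is bounded, then `p ↦ ∫ y in K, H (y, p) ∂μ` is
`C^∞` for every measure `μ` finite on compact sets (Evans, App. C.4; Hörmander, Thm. 1.1.9,
iterated differentiation under the integral sign). [folklore] -/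
theorem contDiff_parametric_setIntegral {K : Set Y} (hK : IsBounded K) (hKm : MeasurableSet K)
    {H : Y × P → F} (hH : ContDiff ℝ ∞ H) : ContDiff ℝ ∞ fun p : P => ∫ y in K, H (y, p) ∂μ :=
  contDiff_infty.2 fun n => contDiff_nat_parametric_setIntegral hK hKm n hH

end Literature.Analysis.FunctionSpaces

end
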